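import Summits.CriticalPhenomena.CardyFormulaZ2.Theorems.CardyBoundaryCoulombGasRectilinearCardyStubSchwarzExtensionPart1
import HarnessLib

/-!
# Stub `stub_schwarzExtension` of line `excursion-kernel-covariance`
# (crux `RectilinearCardy`, stmt-CriticalPhenomena-5660, route `CardyBoundaryCoulombGas`)

Schwarz extension of the inverse uniformizer across the flat pieces of the boundary. Given the datum
of the boundary correspondence of a conformal rectangle `R = (Ω; a, b, c, d)` — a uniformizer
`φ : ℍₒ → Ω`, its real boundary correspondence `g` on a parameter interval `[S₀, S] ⊋ [0, mark 3]`
(`S₀ < 0`, `mark 3 < S < 1`, `S < S₀ + 1`) and an extension `w₀` of `φ⁻¹`, continuous on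
`Ω ∪ ∂Ω([S₀, S])` with the real values `w₀ (∂Ω(t)) = g t` — there is an open `U ⊇ Ω` containing every
FLAT boundary point `∂Ω(t)`, `t ∈ [0, mark 3]`, and a holomorphic `w : U → ℂ` with `w = φ⁻¹` on `Ω`
(so `w : Ω → ℍₒ` is a bijection) and `w (∂Ω(t)) = g t` at those flat points.

Proof. For each flat `t` the local reflection `exists_local_reflection` (part 1) provides a radius
`ρ_t > 0`, a sign `s_t = ±1` (horizontal / vertical side line `L_t` through `x_t = ∂Ω(t)`: every
frontier point within `2ρ_t` of `x_t` is fixed by the reflection `σ_t z = x_t + s_t conj (z - x_t)`)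
and a holomorphic `G_t` on `B_t = B(x_t, ρ_t)` equal to `w₀` on `B_t ∩ Ω̄` and to `conj ∘ w₀ ∘ σ_t`
off `Ω̄`. Put `U = Ω ∪ ⋃_t B_t` and `w = w₀` on `Ω̄`, `w z = conj (w₀ (σ_t z))` for `z ∈ B_t ∖ Ω̄`
(any such `t`). This is well defined: if `B_t ∩ B_{t'} ≠ ∅`, say `ρ_{t'} ≤ ρ_t`, then
`dist (x_t, x_{t'}) < 2ρ_t`, so `x_{t'} ∈ L_t`; the signs agree (otherwise the frontier near
`x_{t'}` would lie on two perpendicular lines, i.e. reduce to `{x_{t'}}`, while boundary points of a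
Jordan domain are not isolated in the frontier, `exists_mem_frontier_ne`), hence `σ_t = σ_{t'}`.
So `w = G_t` on every `B_t` and `w = w₀ = φ⁻¹` on the open `Ω`, and `w` is holomorphic on `U`.
-/

noncomputable section

open Set Filter Topology Metric
open scoped ComplexConjugate
open Literature.Probability.RandomPlanarGeometry
open UpperHalfPlane (upperHalfPlaneSet)

namespace Summit.CriticalPhenomena.CardyFormulaZ2.Cruxes.RectilinearCardy.ExcursionKernelCovariance

/-- **Schwarz extension across the flat pieces** (stub 8 of line `excursion-kernel-covariance`).
Given the datum of the boundary correspondence (`φ`, `g`, `S₀`, `S`, `w₀`), the inverse uniformizer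
`φ⁻¹` extends to a holomorphic `w` on an open `U ⊇ Ω` containing every flat boundary point `∂Ω(t)`,
`t ∈ [0, mark 3]`, with `w (∂Ω(t)) = g t` there and `w = φ⁻¹` on `Ω` (so `w : Ω → ℍₒ` is a
bijection): Schwarz reflection of `w₀` across the side line in small outer half-discs around the flat
points, consistent on overlaps. Conway, *Functions of One Complex Variable I*, IX.1.1.
[cite: Conway1978, Ch. IX Thm. 1.1] -/
theorem stub_schwarzExtension :
    ∀ (R : ConformalRectangle) (φ : ConformalEquiv upperHalfPlaneSet R.carrier) (g : ℝ → ℝ)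
      (S₀ S : ℝ) (w₀ : ℂ → ℂ),
      S₀ < 0 → R.mark 3 < S → S < 1 → S < S₀ + 1 →
      ContinuousOn g (Icc S₀ S) → (StrictMonoOn g (Icc S₀ S) ∨ StrictAntiOn g (Icc S₀ S)) →
      (∀ t ∈ Icc S₀ S, φ.HasBoundaryValue (g t) (R.boundary t)) →
      EqOn w₀ φ.symm R.carrier → ContinuousOn w₀ (R.carrier ∪ R.boundary '' Icc S₀ S) →
      (∀ t ∈ Icc S₀ S, w₀ (R.boundary t) = g t) →
      ∃ (U : Set ℂ) (w : ℂ → ℂ), IsOpen U ∧ R.carrier ⊆ U ∧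
        (∀ t ∈ Icc (0 : ℝ) (R.mark 3), (∃ r : ℝ, 0 < r ∧ FlatNear R (R.boundary t) r) →
          R.boundary t ∈ U ∧ w (R.boundary t) = g t) ∧
        DifferentiableOn ℂ w U ∧ BijOn w R.carrier {z : ℂ | 0 < z.im} ∧ EqOn w φ.symm R.carrier := by
  intro R φ g S₀ S w₀ hS₀ h3S _hS1 hSS _hgc _hgm _hbv hw₀ hw₀c hw₀g
  classical
  -- `w₀ = φ⁻¹` is holomorphic on `Ω`
  have hd : DifferentiableOn ℂ w₀ R.carrier := φ.symm.differentiableOn_coe.congr hw₀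
  -- the flat parameters and their local reflections
  set F : Set ℝ := {t | t ∈ Icc (0 : ℝ) (R.mark 3) ∧ ∃ r : ℝ, 0 < r ∧ FlatNear R (R.boundary t) r}
    with hF
  have hA : ∀ t : ℝ, ∃ (ρ : ℝ) (s : ℂ) (G : ℂ → ℂ), t ∈ F →
      0 < ρ ∧ (s = 1 ∨ s = -1) ∧
      (∀ z ∈ frontier R.carrier, dist z (R.boundary t) < 2 * ρ →
        R.boundary t + s * conj (z - R.boundary t) = z) ∧
      DifferentiableOn ℂ G (ball (R.boundary t) ρ) ∧
      (∀ z ∈ ball (R.boundary t) ρ, z ∈ closure R.carrier → G z = w₀ z) ∧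
      (∀ z ∈ ball (R.boundary t) ρ, z ∉ closure R.carrier →
        G z = conj (w₀ (R.boundary t + s * conj (z - R.boundary t)))) := by
    intro t
    by_cases htF : t ∈ F
    · obtain ⟨ρ, hρ, s, hs, hfl, G, hG, hG₁, hG₂⟩ :=
        exists_local_reflection R hS₀ h3S hSS hd hw₀c hw₀g htF.1 htF.2
      exact ⟨ρ, s, G, fun _ => ⟨hρ, hs, hfl, hG, hG₁, hG₂⟩⟩
    · exact ⟨0, 0, 0, fun h => absurd h htF⟩
  choose ρ s G hA using hA
  -- the reflections across the side lines
  set σ : ℝ → ℂ → ℂ := fun t z => R.boundary t + s t * conj (z - R.boundary t) with hσ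
  -- consistency: overlapping balls have the same side line
  have key : ∀ t ∈ F, ∀ t' ∈ F, dist (R.boundary t') (R.boundary t) < 2 * ρ t →
      ∀ y, σ t y = σ t' y := by
    intro t ht t' ht' hdd y
    obtain ⟨hρt, hst, hflt, -⟩ := hA t ht
    obtain ⟨hρt', hst', hflt', -⟩ := hA t' ht'
    have e2 : R.boundary t + s t * conj (R.boundary t' - R.boundary t) = R.boundary t' :=
      hflt _ (R.boundary_mem_frontier t') hdd
    have hss : s t' = s t := by
      by_contra hne
      have hneg : s t' = -s t := by
        rcases hst with h | h <;> rcases hst' with h' | h'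
        · exact absurd (h'.trans h.symm) hne
        · rw [h, h']
        · rw [h, h', neg_neg]
        · exact absurd (h'.trans h.symm) hne
      have hε0 : 0 < min (2 * ρ t') (2 * ρ t - dist (R.boundary t') (R.boundary t)) :=
        lt_min (by linarith) (by linarith)
      obtain ⟨z, hz, hzd, hzne⟩ := exists_mem_frontier_ne R.toJordanDomain t' hε0
      have e1 : R.boundary t + s t * conj (z - R.boundary t) = z := by
        refine hflt z hz ?_
        have := min_le_right (2 * ρ t') (2 * ρ t - dist (R.boundary t') (R.boundary t))
        calc dist z (R.boundary t)
            ≤ dist z (R.boundary t') + dist (R.boundary t') (R.boundary t) := dist_triangle _ _ _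
          _ < 2 * ρ t := by linarith
      have e3 : R.boundary t' + s t' * conj (z - R.boundary t') = z :=
        hflt' z hz (lt_of_lt_of_le hzd (min_le_left _ _))
      rw [hneg] at e3
      apply hzne
      rw [map_sub] at e1 e2 e3
      linear_combination (-(1 : ℂ) / 2) * (e1 - e2 + e3)
    simp only [hσ, hss]
    rw [map_sub] at e2
    rw [map_sub, map_sub]
    linear_combination e2
  have hcons : ∀ t ∈ F, ∀ t' ∈ F, ∀ y, y ∈ ball (R.boundary t) (ρ t) →
      y ∈ ball (R.boundary t') (ρ t') → σ t y = σ t' y := by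
    intro t ht t' ht' y hy hy'
    rw [mem_ball] at hy hy'
    have hdd : dist (R.boundary t') (R.boundary t) < ρ t + ρ t' := by
      calc dist (R.boundary t') (R.boundary t)
          ≤ dist (R.boundary t') y + dist y (R.boundary t) := dist_triangle _ _ _
        _ < ρ t' + ρ t := add_lt_add (by rw [dist_comm]; exact hy') hy
        _ = ρ t + ρ t' := add_comm _ _
    rcases le_total (ρ t') (ρ t) with h | h
    · exact key t ht t' ht' (by linarith) y
    · exact (key t' ht' t ht (by rw [dist_comm]; linarith) y).symm
  -- the open set and the extension
  set U : Set ℂ := R.carrier ∪ ⋃ t ∈ F, ball (R.boundary t) (ρ t) with hU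
  set τ : ℂ → ℝ := fun z => Classical.epsilon fun t => t ∈ F ∧ z ∈ ball (R.boundary t) (ρ t)
    with hτ
  set w : ℂ → ℂ := fun z => if z ∈ closure R.carrier then w₀ z else conj (w₀ (σ (τ z) z)) with hw
  have hwcl : ∀ z ∈ closure R.carrier, w z = w₀ z := fun z hz => by simp [hw, hz]
  have hwG : ∀ t ∈ F, ∀ z ∈ ball (R.boundary t) (ρ t), w z = G t z := by
    intro t ht z hz
    obtain ⟨-, -, -, -, hG₁, hG₂⟩ := hA t ht
    by_cases hzc : z ∈ closure R.carrier
    · rw [hwcl z hzc, hG₁ z hz hzc]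
    · have hτz : τ z ∈ F ∧ z ∈ ball (R.boundary (τ z)) (ρ (τ z)) :=
        Classical.epsilon_spec (p := fun t => t ∈ F ∧ z ∈ ball (R.boundary t) (ρ t)) ⟨t, ht, hz⟩
      rw [hG₂ z hz hzc]
      simp only [hw, if_neg hzc]
      rw [hcons (τ z) hτz.1 t ht z hτz.2 hz]
  have hdiff : DifferentiableOn ℂ w U := by
    intro z hz
    suffices h : DifferentiableAt ℂ w z from h.differentiableWithinAt
    rcases hz with hzΩ | hzB
    · have hev : w =ᶠ[𝓝 z] w₀ := by
        filter_upwards [R.isOpen.mem_nhds hzΩ] with y hy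
        exact hwcl y (subset_closure hy)
      exact (hd.differentiableAt (R.isOpen.mem_nhds hzΩ)).congr_of_eventuallyEq hev
    · obtain ⟨t, ht, hzt⟩ := mem_iUnion₂.1 hzB
      obtain ⟨-, -, -, hGd, -, -⟩ := hA t ht
      have hev : w =ᶠ[𝓝 z] G t := by
        filter_upwards [isOpen_ball.mem_nhds hzt] with y hy
        exact hwG t ht y hy
      exact (hGd.differentiableAt (isOpen_ball.mem_nhds hzt)).congr_of_eventuallyEq hev
  have heq : EqOn w φ.symm R.carrier := fun z hz => (hwcl z (subset_closure hz)).trans (hw₀ hz)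
  refine ⟨U, w, R.isOpen.union (isOpen_biUnion fun t _ => isOpen_ball), subset_union_left, ?_,
    hdiff, heq.bijOn_iff.2 φ.symm.bijOn, heq⟩
  intro t ht hfl
  have htF : t ∈ F := ⟨ht, hfl⟩
  obtain ⟨hρt, -⟩ := hA t htF
  refine ⟨Or.inr (mem_iUnion₂.2 ⟨t, htF, mem_ball_self hρt⟩), ?_⟩
  rw [hwcl _ (frontier_subset_closure (R.boundary_mem_frontier t))]
  exact hw₀g t ⟨by linarith [ht.1], by linarith [ht.2]⟩

end Summit.CriticalPhenomena.CardyFormulaZ2.Cruxes.RectilinearCardy.ExcursionKernelCovariance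

end
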